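import Mathlib
import Literature.Computability.AlgebraicComplexity.DeterminantIrreducible
import Summits.MatrixMultiplication.MatrixMultiplication.Theses.HiddenToeplitzCorners
import Summits.ValiantsHypothesis.ValiantsHypothesis.Theorems.PerDivisionHard.Negative.VarsCounting

/-!
# `HiddenToeplitzCorners.CheapIdealMembers` — the floor: exponent `2` is optimal

Item `stmt-MatrixMultiplication-7497` (support of route `HiddenToeplitzCorners`) asks, for every
`ε > 0` and infinitely many `r`, for a nonzero `f ∈ ℂ[X_r]` with `det X_r ∣ f` and division-free
fan-in-two `complexity f ≤ r^(2+ε)`.  This file records the (folklore, input-reading) reason why the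
exponent `2` there cannot be lowered, i.e. why the item is stated at the optimal exponent:

* `vars_eq_univ_of_det_dvd` — a nonzero multiple `f` of `det X_r` involves every one of the `r²`
  variables (`ℂ[X]` is a domain, so `degreeOf v (det · g) = degreeOf v det + degreeOf v g ≥ 1`, using
  the tree's `degreeOf_detPoly : degreeOf v det = 1`);
* `sq_le_two_mul_complexity_add_one_of_det_dvd` — hence `r² ≤ 2 · complexity f + 1`, by the
  variable-counting floor `#vars(f) ≤ 2·L(f) + 1` for the tree's `complexity`
  (`card_vars_le_complexity`, proved in the tree for the permanent programme and reused here);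
* `cheapIdealMembers_floor` — the same packaged against the item's own quantifier shape: for every
  `r` and every admissible witness `f` of `CheapIdealMembers` at `r`, `(r² − 1)/2 ≤ complexity f`;
* `cheapIdealMembers_sharp`, `not_cheapIdealMembers_below_two` — the refuted strengthening: for
  every `ε > 0` eventually every admissible `f` has `complexity f > r^(2-ε)`, so the item with
  exponent `2 - ε` in place of `2 + ε` is false.

So the companion rung "`complexity ≥ C·r²` for every `C < 1/2`" is free, `CheapIdealMembers` sits
exactly one `r^ε` above the trivial floor, and (file `HiddenToeplitzCornersCheapIdealMembers.lean`)
reaching it is `ω(ℂ) = 2`.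
-/

-- `Summit.<Summit>.<Problem>` is the tree's mandated summit-side namespace; for this
-- single-conjunct summit the two coincide, so the file silences `dupNamespace`.
set_option linter.dupNamespace false

namespace Summit.MatrixMultiplication.MatrixMultiplication.Theorems

open Literature.Computability.AlgebraicComplexity MvPolynomial

/-- A nonzero multiple of the generic determinant `det X_r` involves all `r²` variables. -/
theorem vars_eq_univ_of_det_dvd {r : ℕ} {f : MvPolynomial (Fin r × Fin r) ℂ} (hf : f ≠ 0)
    (hd : (Matrix.mvPolynomialX (Fin r) (Fin r) ℂ).det ∣ f) : f.vars = Finset.univ := by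
  obtain ⟨g, rfl⟩ := hd
  have hdet : (Matrix.mvPolynomialX (Fin r) (Fin r) ℂ).det ≠ 0 :=
    Matrix.det_mvPolynomialX_ne_zero (Fin r) ℂ
  have hg : g ≠ 0 := by
    rintro rfl
    exact hf (mul_zero _)
  ext v
  simp only [Finset.mem_univ, iff_true]
  rw [vars_def, Multiset.mem_toFinset, ← Multiset.count_pos, ← degreeOf_def,
    degreeOf_mul_eq hdet hg]
  have h1 : degreeOf v (Matrix.mvPolynomialX (Fin r) (Fin r) ℂ).det = 1 := by
    simpa [detPoly] using degreeOf_detPoly (R := ℂ) (n := Fin r) v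
  omega

/-- **Floor.** If `f ≠ 0` and `det X_r ∣ f` then `r² ≤ 2 · complexity f + 1`: a fan-in-two circuit of
size `s` mentions at most `2s + 1` variables (`card_vars_le_complexity`), and `f` mentions all
`r²` of them. -/
theorem sq_le_two_mul_complexity_add_one_of_det_dvd {r : ℕ} {f : MvPolynomial (Fin r × Fin r) ℂ}
    (hf : f ≠ 0) (hd : (Matrix.mvPolynomialX (Fin r) (Fin r) ℂ).det ∣ f) :
    r ^ 2 ≤ 2 * complexity f + 1 := by
  have h := Summit.ValiantsHypothesis.Theorems.PerDivisionHardNegative.card_vars_le_complexity f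
  rw [vars_eq_univ_of_det_dvd hf hd, Finset.card_univ, Fintype.card_prod, Fintype.card_fin] at h
  simpa [sq] using h

/-- **The item's witnesses all sit above the quadratic floor.** For every `r` and every `f`
admissible in `CheapIdealMembers` at `r` (nonzero, divisible by `det X_r`),
`(r² − 1)/2 ≤ complexity f` (real form of `sq_le_two_mul_complexity_add_one_of_det_dvd`); so the
exponent `2 + ε` of item `stmt-MatrixMultiplication-7497` cannot be replaced by anything below `2`. -/
theorem cheapIdealMembers_floor (r : ℕ) (f : MvPolynomial (Fin r × Fin r) ℂ) (hf : f ≠ 0)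
    (hd : (Matrix.mvPolynomialX (Fin r) (Fin r) ℂ).det ∣ f) :
    ((r : ℝ) ^ 2 - 1) / 2 ≤ (complexity f : ℝ) := by
  have h := sq_le_two_mul_complexity_add_one_of_det_dvd hf hd
  have h' : ((r ^ 2 : ℕ) : ℝ) ≤ ((2 * complexity f + 1 : ℕ) : ℝ) := by exact_mod_cast h
  push_cast at h'
  linarith

/-- **Sharpness of the exponent (a refuted strengthening of the item).** For every `ε > 0`, for all
large `r`, EVERY nonzero multiple `f` of `det X_r` has `complexity f > r^(2-ε)`: the variant of
`CheapIdealMembers` with exponent `2 - ε` in place of `2 + ε` is false (not even frequently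
attainable). Elementary from `cheapIdealMembers_floor` (`r^(2-ε) ≤ r²/4 < (r²-1)/2` once `r^ε ≥ 4`,
`r ≥ 2`). -/
theorem cheapIdealMembers_sharp {ε : ℝ} (hε : 0 < ε) :
    ∀ᶠ r : ℕ in Filter.atTop, ∀ f : MvPolynomial (Fin r × Fin r) ℂ, f ≠ 0 →
      (Matrix.mvPolynomialX (Fin r) (Fin r) ℂ).det ∣ f → (r : ℝ) ^ (2 - ε) < (complexity f : ℝ) := by
  have hev : ∀ᶠ r : ℕ in Filter.atTop, (4 : ℝ) ≤ (r : ℝ) ^ ε :=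
    ((tendsto_rpow_atTop hε).comp tendsto_natCast_atTop_atTop).eventually_ge_atTop 4
  filter_upwards [hev, Filter.eventually_ge_atTop 2] with r hr hr2 f hf hd
  have hfloor := cheapIdealMembers_floor r f hf hd
  have hr0 : (0 : ℝ) < r := by exact_mod_cast (by omega : 0 < r)
  have hr2' : (2 : ℝ) ≤ r := by exact_mod_cast hr2
  have hsplit : (r : ℝ) ^ (2 - ε) * (r : ℝ) ^ ε = (r : ℝ) ^ 2 := by
    rw [← Real.rpow_add hr0, sub_add_cancel, Real.rpow_two]
  have h4 : (r : ℝ) ^ (2 - ε) * 4 ≤ (r : ℝ) ^ 2 := by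
    rw [← hsplit]
    exact mul_le_mul_of_nonneg_left hr (Real.rpow_nonneg hr0.le _)
  have hr4 : (4 : ℝ) ≤ (r : ℝ) ^ 2 := by nlinarith
  linarith

/-- The refuted strengthening, in the item's own quantifier shape: `CheapIdealMembers` with the
exponent `2 + ε` replaced by `2 - ε` fails (already at any single `ε > 0`, e.g. `ε = 1`). -/
theorem not_cheapIdealMembers_below_two :
    ¬ ∀ ε : ℝ, 0 < ε → ∃ᶠ r : ℕ in Filter.atTop, ∃ f : MvPolynomial (Fin r × Fin r) ℂ, f ≠ 0 ∧
      (Matrix.mvPolynomialX (Fin r) (Fin r) ℂ).det ∣ f ∧ (complexity f : ℝ) ≤ (r : ℝ) ^ (2 - ε) := by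
  intro h
  refine (h 1 one_pos) ?_
  filter_upwards [cheapIdealMembers_sharp one_pos] with r hr
  rintro ⟨f, hf, hd, hc⟩
  exact not_le_of_gt (hr f hf hd) hc

end Summit.MatrixMultiplication.MatrixMultiplication.Theorems
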